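import Mathlib
import HarnessLib
import Summits.CriticalPhenomena.CardyFormulaZ2.Theses.CardySelfDualSegment
import Literature.Probability.Percolation.CornerPercolation
import Literature.Barriers.CriticalPhenomena.EmbeddingModulusUniquenessProofs
import Literature.Probability.RandomPlanarGeometry.ConformalRectangleProofs
import Literature.Probability.RandomPlanarGeometry.CardyFunction
import Summits.CriticalPhenomena.CardyFormulaZ2.Theorems.CardySelfDualSegmentSegmentOpenStubCrossingProbPolynomial
import Summits.CriticalPhenomena.CardyFormulaZ2.Theorems.CardySelfDualSegmentSegmentOpenStubShearCrossRatioAnalytic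
import Summits.CriticalPhenomena.CardyFormulaZ2.Theorems.CardySelfDualSegmentSegmentOpenStubGoodSetUnivOfGlobalJets
import Summits.CriticalPhenomena.CardyFormulaZ2.Theorems.SegmentOpen.Negative.NormOne
import Summits.CriticalPhenomena.CardyFormulaZ2.Theorems.SegmentOpen.Negative.FrozenModulus

/-!
# Crux `SegmentOpen` (stmt-CriticalPhenomena-5471), line `Sketch` — the JI curve IS the modulus function, and it is pinned

Lead c5, reshape 7 (GLOBAL JETS), companion of GJ (`stub_goodSet_univ_of_globalJets`, p134197).
GJ concludes `t ∈ G` (an existential modulus); its proof shows more: under S4w and JC, for a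
modulus curve `α` with the JI property the good point `t` has modulus EXACTLY `α t`
(`cardyModAt_curve_of_globalJets`).  Consequently (`jetCurve_pinned`) any JI curve is pinned by the
landed negative lemmas: `α 0 = ζ` (`modulus_zero_eq_triZeta`), `α 1 = i` (`modulus_one_eq_I`) and
`‖α t‖ = 1` for all `t` (`norm_eq_one_of_cardyMod`) — the tests any explicit candidate for the
modulus motion `t ↦ α(t)` of the corner family must pass, and (with `modulus_unique'`) the JI
curve is unique on `[0,1]`.  S4w and JC enter as hypotheses (verbatim the registered stubs; NOT
claimed).
-/

noncomputable section

namespace Summit.CriticalPhenomena.CardyFormulaZ2.Theorems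

open Literature.Probability Literature.Barriers.CriticalPhenomena
open Literature.Probability.RandomPlanarGeometry (ConformalRectangle ConformalEquiv MarkedDomain)
open Filter Set Topology MeasureTheory
open UpperHalfPlane (upperHalfPlaneSet)

open GoodSetUnivOfGlobalJets in
/-- **The JI curve is the modulus function.**  Under S4w and JC (hypotheses), if `α` is
real-analytic on `[0,1]` with `0 < im α` and has the JI property (the perturbation series of the
coefficient limits of every `R'` sums near `0⁺` to `F(M(α s))`), then for EVERY `t ∈ [0,1]` the
corner model `M_t` has Cardy limits after the shear `φ_{α t}`: `CardyMod t (α t)`. (Same proof as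
GJ, with the witness exposed.) -/
theorem cardyModAt_curve_of_globalJets :
    (∀ (t₀ : unitInterval) (R : ConformalRectangle), ∃ r > 0, ∃ δ₁ > 0, ∃ C : ℝ, ∀ δ : ℝ,
      0 < δ → δ < δ₁ → ∀ p : Polynomial ℝ,
        (∀ t : unitInterval, Percolation.cornerCrossingProb t R δ = p.eval (t : ℝ)) →
        ∀ z ∈ Metric.ball ((t₀ : ℝ) : ℂ) r, ‖(p.map (algebraMap ℝ ℂ)).eval z‖ ≤ C) →
    (∀ (R' : ConformalRectangle) (k : ℕ), ∃ a : ℝ, ∀ ε > 0, ∃ δ₀ > 0, ∀ δ : ℝ, 0 < δ → δ < δ₀ →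
      ∀ p : Polynomial ℝ,
        (∀ t : unitInterval, Percolation.cornerCrossingProb t R' δ = p.eval (t : ℝ)) →
        |p.coeff k - a| < ε) →
    ∀ {α : ℝ → ℂ}, AnalyticOnNhd ℝ α (Set.Icc 0 1) → (∀ s ∈ Set.Icc (0 : ℝ) 1, 0 < (α s).im) →
      (∀ (R' : ConformalRectangle) (M : ℂ → ℝ), AnalyticOnNhd ℝ M {β : ℂ | 0 < β.im} →
        (∀ β : ℂ, 0 < β.im → ∀ (R : ConformalRectangle)
            (φ : ConformalEquiv UpperHalfPlane.upperHalfPlaneSet R.carrier) (x : Fin 4 → ℝ),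
            R.carrier = moduliShear β '' R'.carrier → (∀ i, R.pt i = moduliShear β (R'.pt i)) →
            R.IsUniformizing φ x → RandomPlanarGeometry.crossRatio x = M β) →
        ∀ a : ℕ → ℝ,
          (∀ k : ℕ, ∀ ε > 0, ∃ δ₀ > 0, ∀ δ : ℝ, 0 < δ → δ < δ₀ → ∀ p : Polynomial ℝ,
              (∀ t : unitInterval, Percolation.cornerCrossingProb t R' δ = p.eval (t : ℝ)) →
              |p.coeff k - a k| < ε) →
          ∃ ε > 0, ∀ s : ℝ, 0 ≤ s → s < ε →
            HasSum (fun k : ℕ => a k * s ^ k) (RandomPlanarGeometry.cardyFunction (M (α s)))) →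
      ∀ (t : unitInterval) (R R' : ConformalRectangle)
        (φ : ConformalEquiv UpperHalfPlane.upperHalfPlaneSet R.carrier) (x : Fin 4 → ℝ),
        R.carrier = moduliShear (α t) '' R'.carrier →
        (∀ i, R.pt i = moduliShear (α t) (R'.pt i)) → R.IsUniformizing φ x →
        Tendsto (Percolation.cornerCrossingProb t R') (𝓝[>] 0)
          (𝓝 (RandomPlanarGeometry.cardyFunction (RandomPlanarGeometry.crossRatio x))) := by
  intro h4 hJC α hαan hαim hJ t
  classical
  have ht01 : (t : ℝ) ∈ Icc (0 : ℝ) 1 := t.2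
  intro R R' φ x hcar hpt hunif
  -- the modulus function of `R'` (S7)
  obtain ⟨M, hMan, hM⟩ := stub_shearCrossRatioAnalytic R'
  have hcr : RandomPlanarGeometry.crossRatio x = M (α t) :=
    hM (α t) (hαim _ ht01) R φ x hcar hpt hunif
  have hM01 : ∀ β : ℂ, 0 < β.im → M β ∈ Ioo (0 : ℝ) 1 := fun β hβ => by
    obtain ⟨Q, ψ, y, hc, hp, hψ⟩ := exists_shear_presentation R' hβ.ne'
    rw [← hM β hβ Q ψ y hc hp hψ]
    exact ConformalRectangle.crossRatio_mem_Ioo_of_isUniformizing hψ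
  -- crossing polynomials of `R'` (S1)
  set P : ℝ → Polynomial ℝ := fun δ =>
    if hδ : 0 < δ then Classical.choose (stub_crossingProbPolynomial R' δ hδ) else 0 with hP
  have hPspec : ∀ δ : ℝ, 0 < δ → ∀ s : unitInterval,
      Percolation.cornerCrossingProb s R' δ = (P δ).eval (s : ℝ) := fun δ hδ => by
    simp only [hP, dif_pos hδ]
    exact Classical.choose_spec (stub_crossingProbPolynomial R' δ hδ)
  -- coefficient limits (JC) and their identification near `0⁺` (JI)
  choose a ha using hJC R'
  obtain ⟨ε, hε, hsum⟩ := hJ R' M hMan hM a ha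
  -- the comparison function is real-analytic on `[0,1]`
  have hh : AnalyticOnNhd ℝ (fun s : ℝ => RandomPlanarGeometry.cardyFunction (M (α s)))
      (Icc 0 1) := by
    intro s hs
    have him := hαim s hs
    have h2 : AnalyticAt ℝ (fun s : ℝ => M (α s)) s := (hMan _ him).comp_of_eq (hαan s hs) rfl
    exact (RandomPlanarGeometry.analyticOnNhd_cardyFunction_Ioo _ (hM01 _ him)).comp_of_eq h2 rfl
  rw [hcr]
  -- reduce to sequences of meshes
  rw [tendsto_iff_seq_tendsto]
  intro d hd
  have key := tendsto_eval_of_globalJets (P := P)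
    (fun t₀ => by
      obtain ⟨r, hr, δ₁, hδ₁, C, hC⟩ := h4 t₀ R'
      exact ⟨r, hr, δ₁, hδ₁, C, fun δ hδ hδ' z hz => hC δ hδ hδ' (P δ) (hPspec δ hδ) z hz⟩)
    (fun k e he => by
      obtain ⟨δ₀, hδ₀, h⟩ := ha k e he
      exact ⟨δ₀, hδ₀, fun δ hδ hδ' => h δ hδ hδ' (P δ) (hPspec δ hδ)⟩)
    hh hε hsum hd t
  have hgood : ∀ᶠ n in atTop, 0 < d n := by
    have h1 : ∀ᶠ n in atTop, d n ∈ Ioi 0 := hd self_mem_nhdsWithin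
    exact h1.mono fun n hn => hn
  refine key.congr' ?_
  filter_upwards [hgood] with n hn
  exact (hPspec (d n) hn t).symm

/-- **The JI curve is pinned.**  Under S4w and JC (hypotheses), any modulus curve `α` with the
JI property satisfies `α 0 = ζ = e^{iπ/3}` (Smirnov's modulus), `α 1 = i` (quarter-turn pinning of
bond-`ℤ²`) and `‖α t‖ = 1` for every `t ∈ [0,1]` (diagonal-reflection symmetry of `M_t`) — by the
landed negative lemmas `modulus_zero_eq_triZeta`, `modulus_one_eq_I`, `norm_eq_one_of_cardyMod`
applied to the good moduli `α t` of `cardyModAt_curve_of_globalJets`. -/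
theorem jetCurve_pinned :
    (∀ (t₀ : unitInterval) (R : ConformalRectangle), ∃ r > 0, ∃ δ₁ > 0, ∃ C : ℝ, ∀ δ : ℝ,
      0 < δ → δ < δ₁ → ∀ p : Polynomial ℝ,
        (∀ t : unitInterval, Percolation.cornerCrossingProb t R δ = p.eval (t : ℝ)) →
        ∀ z ∈ Metric.ball ((t₀ : ℝ) : ℂ) r, ‖(p.map (algebraMap ℝ ℂ)).eval z‖ ≤ C) →
    (∀ (R' : ConformalRectangle) (k : ℕ), ∃ a : ℝ, ∀ ε > 0, ∃ δ₀ > 0, ∀ δ : ℝ, 0 < δ → δ < δ₀ →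
      ∀ p : Polynomial ℝ,
        (∀ t : unitInterval, Percolation.cornerCrossingProb t R' δ = p.eval (t : ℝ)) →
        |p.coeff k - a| < ε) →
    ∀ {α : ℝ → ℂ}, AnalyticOnNhd ℝ α (Set.Icc 0 1) → (∀ s ∈ Set.Icc (0 : ℝ) 1, 0 < (α s).im) →
      (∀ (R' : ConformalRectangle) (M : ℂ → ℝ), AnalyticOnNhd ℝ M {β : ℂ | 0 < β.im} →
        (∀ β : ℂ, 0 < β.im → ∀ (R : ConformalRectangle)
            (φ : ConformalEquiv UpperHalfPlane.upperHalfPlaneSet R.carrier) (x : Fin 4 → ℝ),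
            R.carrier = moduliShear β '' R'.carrier → (∀ i, R.pt i = moduliShear β (R'.pt i)) →
            R.IsUniformizing φ x → RandomPlanarGeometry.crossRatio x = M β) →
        ∀ a : ℕ → ℝ,
          (∀ k : ℕ, ∀ ε > 0, ∃ δ₀ > 0, ∀ δ : ℝ, 0 < δ → δ < δ₀ → ∀ p : Polynomial ℝ,
              (∀ t : unitInterval, Percolation.cornerCrossingProb t R' δ = p.eval (t : ℝ)) →
              |p.coeff k - a k| < ε) →
          ∃ ε > 0, ∀ s : ℝ, 0 ≤ s → s < ε →
            HasSum (fun k : ℕ => a k * s ^ k) (RandomPlanarGeometry.cardyFunction (M (α s)))) →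
      α 0 = LatticeModels.triZeta ∧ α 1 = Complex.I ∧ ∀ t : unitInterval, ‖α t‖ = 1 := by
  intro h4 hJC α hαan hαim hJ
  have hgood : ∀ t : unitInterval,
      SegmentOpen.Negative.CardyMod' (Percolation.cornerCrossingProb t) (α t) := fun t =>
    cardyModAt_curve_of_globalJets h4 hJC hαan hαim hJ t
  refine ⟨?_, ?_, fun t => ?_⟩
  · have h := SegmentOpen.Negative.modulus_zero_eq_triZeta
      (hαim 0 (left_mem_Icc.2 zero_le_one)) (by simpa using hgood 0)
    simpa using h
  · have h := SegmentOpen.Negative.modulus_one_eq_I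
      (hαim 1 (right_mem_Icc.2 zero_le_one)) (by simpa using hgood 1)
    simpa using h
  · exact SegmentOpen.Negative.norm_eq_one_of_cardyMod t (hαim _ t.2) (hgood t)

end Summit.CriticalPhenomena.CardyFormulaZ2.Theorems
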